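import Mathlib
import Summits.NavierStokesRegularity.NavierStokesRegularity.Theorems.EulerZoomLiouvillePowerGaugeEulerLiouvilleSelfSimilarBernoulliSqueezeFreeOrbit
import Summits.NavierStokesRegularity.NavierStokesRegularity.Theorems.EulerZoomLiouvillePowerGaugeEulerLiouvilleSelfSimilarBernoulliSqueezeFreeCrossing
import HarnessLib

/-!
# «FAST VORTICAL CHANNELS SQUEEZE VOLUME TOO FAST» with no growth hypothesis — THE EXIT SET OF A VORTICAL BERNOULLI-HIGH BLOB HAS SMALL MEASURE
# (crux `EulerZoomLiouville.PowerGaugeEulerLiouville` = stmt-NavierStokesRegularity-19832, line `birth`, THE ONE STATEMENT; LEAD's RESIDUE-MEMO-19832-g12 target T3)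

Route №10 `EulerZoomLiouville` (NavierStokesRegularity); width seat ns-ezl-w5 g2.  T3d «no upper rate»: under the backward cut-off similarity flow `Φ_{−t}`
(cut-off radius `R_b`), the points of a blob `A` of far vortical Bernoulli-high points (`‖y‖ < M/4`) whose orbit LEAVES the ball `‖z‖ ≤ M/2` before time `T`
form a set of measure `≲_T  γ²·vol({ℋ>h} ∩ {‖z‖ ≥ M/4}) + M^{−2}∫_{B_M}|U|²` — small for `M` large, with NO growth hypothesis on `U`: each such orbit CROSSES the
shell `M/4 ≤ ‖z‖ ≤ M/2` as a TRUE, vortical, Bernoulli-high, far orbit (`Loc.backwardOrbit_good_of_inside`), so `(log 2)² ≤ T ∫(⟪Y,WY⟫/‖Y‖²)²` along the crossing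
(`Loc.sq_log_le_mul_integral_sq`); Tonelli over the closed stay set (`Loc.isClosed_backwardStaySet`) and the flow's change of variables with Jacobian `e^{3γt}`
(`Loc.lintegral_comp_backwardFlow_eq_of_stay`) bound the blob-integral of that quantity by `T e^{3γT} ∫_{shell ∩ {ℋ>h}} (⟪z,Wz⟫/‖z‖²)²`, and on the shell
`(⟪z, γz + Uz⟫/‖z‖²)² ≤ 2γ² + 32M^{−2}‖U z‖²`.

* **`Loc.volume_exitSet_mul_le`** — the estimate.  Consumer: `…SqueezeFree` (the squeeze with the one-sided channel ONLY).

HONEST LABEL: a tool for ONE dynamical sub-stratum of THE ONE STATEMENT.  WHAT THIS IS NOT: not NS, not E — 19832 is a crux CLASS on the MODEL lattice (E/NS strata)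
and stays OPEN; NS regularity is NOT proved. [folklore; ConstantinIgnatovaVicol2026Putative §3.4.1 (3.21)–(3.22), §3.4.3 (3.30)–(3.33)]
-/

noncomputable section

-- flat `Theorems/<Route><Decl>…` files of one crux share the namespace of the crux (tree convention)
set_option linter.dupNamespace false

open MeasureTheory Set Filter Topology Metric Function InnerProductSpace
open scoped RealInnerProductSpace NNReal ENNReal ContDiff

namespace Summit.NavierStokesRegularity.NavierStokesRegularity.Theorems.PowerGaugeEulerLiouville.Loc

open Literature.Analysis Literature.Analysis.FluidPDE
open Summit.NavierStokesRegularity.NavierStokesRegularity.Theorems.PowerGaugeEulerLiouville.BernoulliLandscape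

variable {γ : ℝ} {U : EuclideanSpace ℝ (Fin 3) → EuclideanSpace ℝ (Fin 3)} {P : EuclideanSpace ℝ (Fin 3) → ℝ}

/-- On the shell `M/4 ≤ ‖z‖`, the squared radial rate of `γz + U z` is at most `2γ² + 32M⁻²‖U z‖²`. [folklore] -/
theorem sq_radialRate_le {γ M : ℝ} (hM : 0 < M) {z : EuclideanSpace ℝ (Fin 3)} (hz : M / 4 ≤ ‖z‖)
    (Uz : EuclideanSpace ℝ (Fin 3)) :
    (⟪z, γ • z + Uz⟫ / ‖z‖ ^ 2) ^ 2 ≤ 2 * γ ^ 2 + 32 / M ^ 2 * ‖Uz‖ ^ 2 := by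
  have hz0 : 0 < ‖z‖ := lt_of_lt_of_le (by positivity) hz
  have hz2 : 0 < ‖z‖ ^ 2 := by positivity
  have h1 : ⟪z, γ • z + Uz⟫ / ‖z‖ ^ 2 = γ + ⟪z, Uz⟫ / ‖z‖ ^ 2 := by
    rw [inner_add_right, real_inner_smul_right, real_inner_self_eq_norm_sq]
    field_simp
  have h2 : |⟪z, Uz⟫| ≤ ‖z‖ * ‖Uz‖ := abs_real_inner_le_norm _ _
  have h3 : (⟪z, Uz⟫ / ‖z‖ ^ 2) ^ 2 ≤ ‖Uz‖ ^ 2 / ‖z‖ ^ 2 := by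
    rw [div_pow, div_le_div_iff₀ (by positivity) hz2]
    have h4 : ⟪z, Uz⟫ ^ 2 ≤ (‖z‖ * ‖Uz‖) ^ 2 := by
      rw [← sq_abs]; exact pow_le_pow_left₀ (abs_nonneg _) h2 2
    nlinarith [h4]
  have h5 : ‖Uz‖ ^ 2 / ‖z‖ ^ 2 ≤ 16 / M ^ 2 * ‖Uz‖ ^ 2 := by
    rw [div_le_iff₀ hz2]
    have h6 : M ^ 2 / 16 ≤ ‖z‖ ^ 2 := by nlinarith
    have h7 : 0 ≤ ‖Uz‖ ^ 2 := sq_nonneg _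
    calc ‖Uz‖ ^ 2 = 16 / M ^ 2 * ‖Uz‖ ^ 2 * (M ^ 2 / 16) := by field_simp
      _ ≤ 16 / M ^ 2 * ‖Uz‖ ^ 2 * ‖z‖ ^ 2 := mul_le_mul_of_nonneg_left h6 (by positivity)
  rw [h1]
  set x : ℝ := ⟪z, Uz⟫ / ‖z‖ ^ 2 with hx
  have h8 : (γ + x) ^ 2 ≤ 2 * γ ^ 2 + 2 * x ^ 2 := by nlinarith [sq_nonneg (γ - x)]
  calc (γ + x) ^ 2 ≤ 2 * γ ^ 2 + 2 * x ^ 2 := h8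
    _ ≤ 2 * γ ^ 2 + 2 * (16 / M ^ 2 * ‖Uz‖ ^ 2) := by linarith [h3.trans h5]
    _ = 2 * γ ^ 2 + 32 / M ^ 2 * ‖Uz‖ ^ 2 := by ring

set_option maxHeartbeats 800000 in
/-- **THE EXIT SET HAS SMALL MEASURE.**  `(U,P)` a `C²` CIV (3.3) profile, `γ ≤ ½`; `Ṽ ∈ C²` (`‖DṼ‖ ≤ K`) with `γz + Ṽz = γz + Uz` on `‖z‖ < R_b` and `Ṽ`
divergence-free on `‖z‖ ≤ R_b − 1`; the one-sided channel `⟪z, γz + Uz⟫ ≤ −c₁‖z‖²` (`c₁ > 0`) at the vortical points of `{ℋ > h}` beyond `R₀`; `A` a measurable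
set of such points with `0 < ‖y‖ < M/4` (`M > 0`, `M/2 ≤ R_b − 1`), `T > 0`.  Then, `Φ` denoting the flow of `γz + Ṽz`,
`vol({y ∈ A | ∃ σ ∈ [0,T], ‖Φ_{−σ} y‖ > M/2}) · (log 2)²/T ≤ T · e^{3γT} · (2γ² · vol({ℋ > h} ∩ {‖z‖ ≥ M/4}) + 32M⁻² ∫_{B_M} ‖U‖²)`.
[folklore; ConstantinIgnatovaVicol2026Putative §3.4] -/
theorem volume_exitSet_mul_le (hprof : IsSelfSimilarEulerProfile γ 0 U P) (hγ : 0 ≤ γ) (hγ2 : γ ≤ 1 / 2)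
    {V : EuclideanSpace ℝ (Fin 3) → EuclideanSpace ℝ (Fin 3)} (hV2 : ContDiff ℝ 2 V) {K : ℝ}
    (hK : ∀ y : EuclideanSpace ℝ (Fin 3), ‖fderiv ℝ V y‖ ≤ K) {Rb : ℝ}
    (hWU : ∀ z : EuclideanSpace ℝ (Fin 3), ‖z‖ < Rb → selfSimilarTransport γ 0 V z = selfSimilarTransport γ 0 U z)
    (hdiv : ∀ z : EuclideanSpace ℝ (Fin 3), ‖z‖ ≤ Rb - 1 → VectorCalculus.divergence V z = 0)
    {h R₀ c₁ : ℝ} (hc₁ : 0 < c₁)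
    (hfastR : ∀ z : EuclideanSpace ℝ (Fin 3), R₀ ≤ ‖z‖ → h < selfSimilarBernoulli γ 0 U P z → curl U z ≠ 0 →
      ⟪z, selfSimilarTransport γ 0 U z⟫ ≤ -(c₁ * ‖z‖ ^ 2))
    {A : Set (EuclideanSpace ℝ (Fin 3))} (hAm : MeasurableSet A) (hAR₀ : ∀ y ∈ A, R₀ ≤ ‖y‖) (hA0 : ∀ y ∈ A, 0 < ‖y‖)
    (hAh : ∀ y ∈ A, h < selfSimilarBernoulli γ 0 U P y) (hAc : ∀ y ∈ A, curl U y ≠ 0)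
    {M T : ℝ} (hM : 0 < M) (hT : 0 < T) (hAM : ∀ y ∈ A, ‖y‖ < M / 4) (hMRb : M / 2 ≤ Rb - 1) :
    volume (A ∩ {y | ∃ σ ∈ Icc 0 T, M / 2 < ‖ODE.evolutionMap (fun _ : ℝ => selfSimilarTransport γ 0 V) 0 (-σ) y‖}) *
        ENNReal.ofReal ((Real.log 2) ^ 2 / T) ≤
      ENNReal.ofReal T * ENNReal.ofReal (Real.exp (3 * γ * T)) *
        (ENNReal.ofReal (2 * γ ^ 2) * volume ({z : EuclideanSpace ℝ (Fin 3) | h < selfSimilarBernoulli γ 0 U P z} ∩ {z | M / 4 ≤ ‖z‖}) +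
          ENNReal.ofReal (32 / M ^ 2) * ∫⁻ z in ball (0 : EuclideanSpace ℝ (Fin 3)) M, ‖U z‖ₑ ^ 2) := by
  set Hb : EuclideanSpace ℝ (Fin 3) → ℝ := selfSimilarBernoulli γ 0 U P with hHb
  have hHc : Continuous Hb := hprof.contDiff_selfSimilarBernoulli.continuous
  have hUc : Continuous U := hprof.contDiff_velocity.continuous
  have hV1 : ContDiff ℝ 1 V := hV2.of_le (by norm_num)
  set Φ : ℝ → EuclideanSpace ℝ (Fin 3) → EuclideanSpace ℝ (Fin 3) :=
    ODE.evolutionMap (fun _ : ℝ => selfSimilarTransport γ 0 V) 0 with hΦ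
  have hjc : Continuous fun q : ℝ × EuclideanSpace ℝ (Fin 3) => Φ (-q.1) q.2 := by
    have h1 := (C2.Kelvin.contDiff_flow_uncurry (γ := γ) hV2 hK).continuous
    exact h1.comp (continuous_fst.neg.prodMk continuous_snd)
  have hWc : Continuous (selfSimilarTransport γ 0 V) :=
    (PowerGaugeEulerLiouville.Kelvin.contDiff_selfSimilarTransport (γ := γ) hV1).continuous
  have hY : ∀ y t, HasDerivAt (fun r => Φ (-r) y) ((-1 : ℝ) • selfSimilarTransport γ 0 V (Φ (-t) y)) t :=
    fun y t => C2.Kelvin.hasDerivAt_flow_neg (γ := γ) hV1 hK y t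
  -- ### the integrand
  set Sh : Set (EuclideanSpace ℝ (Fin 3)) := {z | M / 4 ≤ ‖z‖ ∧ ‖z‖ ≤ M / 2} with hSh
  set Θ : Set (EuclideanSpace ℝ (Fin 3)) := {z | h < Hb z} with hΘ
  have hShm : MeasurableSet Sh :=
    ((isClosed_le continuous_const continuous_norm).inter (isClosed_le continuous_norm continuous_const)).measurableSet
  have hΘm : MeasurableSet Θ := (isOpen_lt continuous_const hHc).measurableSet
  set q : EuclideanSpace ℝ (Fin 3) → ℝ := fun z => ⟪z, selfSimilarTransport γ 0 V z⟫ / ‖z‖ ^ 2 with hq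
  have hqm : Measurable q := (continuous_id.inner hWc).measurable.div (continuous_norm.pow 2).measurable
  set F : EuclideanSpace ℝ (Fin 3) → ℝ≥0∞ := (Sh ∩ Θ).indicator fun z => ENNReal.ofReal (q z ^ 2) with hF
  have hFm : Measurable F := ((hqm.pow_const 2).ennreal_ofReal).indicator (hShm.inter hΘm)
  -- the stay set and the time–space integrand
  set G : Set (ℝ × EuclideanSpace ℝ (Fin 3)) := {p | 0 ≤ p.1 ∧ ∀ σ ∈ Icc 0 p.1, ‖Φ (-σ) p.2‖ ≤ M / 2} with hG
  have hGc : IsClosed G := isClosed_backwardStaySet (γ := γ) hV2 hK (M / 2)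
  have hGm : MeasurableSet G := hGc.measurableSet
  set gp : ℝ × EuclideanSpace ℝ (Fin 3) → ℝ≥0∞ := G.indicator fun p => F (Φ (-p.1) p.2) with hgp
  have hgpm : Measurable gp := (hFm.comp hjc.measurable).indicator hGm
  set g : ℝ → EuclideanSpace ℝ (Fin 3) → ℝ≥0∞ := fun t y => gp (t, y) with hg
  have hgu : uncurry g = gp := by funext p; rfl
  -- ### (a) the per-orbit lower bound on the exit set
  set E : Set (EuclideanSpace ℝ (Fin 3)) := A ∩ {y | ∃ σ ∈ Icc 0 T, M / 2 < ‖Φ (-σ) y‖} with hE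
  have hlow : ∀ y ∈ E, ENNReal.ofReal ((Real.log 2) ^ 2 / T) ≤ ∫⁻ t in Icc 0 T, g t y := by
    rintro y ⟨hyA, σ, hσ, hσM⟩
    set Y : ℝ → EuclideanSpace ℝ (Fin 3) := fun t => Φ (-t) y with hYdef
    have hYc : Continuous Y := continuous_iff_continuousAt.2 fun t => (hY y t).continuousAt
    have hY0 : Y 0 = y := by simp [hYdef, hΦ, ODE.evolutionMap_self]
    have hy4 : ‖Y 0‖ < M / 4 := by rw [hY0]; exact hAM y hyA
    obtain ⟨t₁, t₂, ht₁0, ht₁₂, ht₂T, hYt₁, hYt₂, hin₂, hfar⟩ :=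
      exists_crossing_times hYc (by linarith : M / 4 < M / 2) hy4 ⟨σ, hσ, hσM.le⟩
    -- the orbit is good on `[0, t₂]`
    have hinside : ∀ s ∈ Icc 0 t₂, ‖Φ (-s) y‖ < Rb := fun s hs => by linarith [hin₂ s hs]
    have hgood := backwardOrbit_good_of_inside hprof hγ2 hV1 hK hWU hc₁ hfastR (hAR₀ y hyA) (hA0 y hyA) (hAh y hyA)
      (hAc y hyA) (ht₁0.trans ht₁₂) hinside
    -- the logarithmic crossing integral
    have hlog := sq_log_le_mul_integral_sq (Y := Y) hWc (hY y) ht₁₂ (by positivity : 0 < M / 4) hfar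
      (by linarith : t₂ - t₁ ≤ T) hT (by rw [hYt₁, hYt₂]; linarith)
    rw [hYt₁, hYt₂, show Real.log (M / 2) - Real.log (M / 4) = Real.log 2 by
      rw [← Real.log_div (by positivity) (by positivity)]; congr 1; field_simp; ring] at hlog
    -- `∫_{t₁}^{t₂} q(Y)² ≤ I(y)`
    have hqc : ContinuousOn (fun s => q (Y s) ^ 2) (Icc t₁ t₂) := by
      have hnum : Continuous fun s => ⟪Y s, selfSimilarTransport γ 0 V (Y s)⟫ := hYc.inner (hWc.comp hYc)
      have hden : ∀ s ∈ Icc t₁ t₂, ‖Y s‖ ^ 2 ≠ 0 := fun s hs =>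
        (pow_pos (lt_of_lt_of_le (by positivity : (0 : ℝ) < M / 4) (hfar s hs)) 2).ne'
      exact (hnum.continuousOn.div (hYc.norm.pow 2).continuousOn hden).pow 2
    have hqi : IntegrableOn (fun s => q (Y s) ^ 2) (Ioc t₁ t₂) volume :=
      (hqc.integrableOn_Icc).mono_set Ioc_subset_Icc_self
    have hint_eq : ENNReal.ofReal (∫ s in t₁..t₂, (⟪Y s, selfSimilarTransport γ 0 V (Y s)⟫ / ‖Y s‖ ^ 2) ^ 2) =
        ∫⁻ s in Ioc t₁ t₂, ENNReal.ofReal (q (Y s) ^ 2) := by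
      rw [intervalIntegral.integral_of_le ht₁₂]
      exact (ofReal_integral_eq_lintegral_ofReal hqi (Eventually.of_forall fun s => sq_nonneg _)).trans rfl
    calc ENNReal.ofReal ((Real.log 2) ^ 2 / T)
        ≤ ENNReal.ofReal (∫ s in t₁..t₂, (⟪Y s, selfSimilarTransport γ 0 V (Y s)⟫ / ‖Y s‖ ^ 2) ^ 2) := by
          refine ENNReal.ofReal_le_ofReal ?_
          rw [div_le_iff₀ hT, mul_comm]
          exact hlog
      _ = ∫⁻ s in Ioc t₁ t₂, ENNReal.ofReal (q (Y s) ^ 2) := hint_eq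
      _ = ∫⁻ s in Ioc t₁ t₂, g s y := by
          refine setLIntegral_congr_fun measurableSet_Ioc (fun s hs => ?_)
          have hsG : (s, y) ∈ G := ⟨ht₁0.trans hs.1.le, fun σ' hσ' => hin₂ σ' ⟨hσ'.1, hσ'.2.trans hs.2⟩⟩
          obtain ⟨-, hH, -, -⟩ := hgood s ⟨ht₁0.trans hs.1.le, hs.2⟩
          have hsSh : Φ (-s) y ∈ Sh ∩ Θ := ⟨⟨hfar s ⟨hs.1.le, hs.2⟩, hin₂ s ⟨ht₁0.trans hs.1.le, hs.2⟩⟩, hH⟩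
          have e1 : g s y = F (Φ (-s) y) := by
            show gp (s, y) = _
            rw [hgp, indicator_of_mem hsG]
          have e2 : F (Φ (-s) y) = ENNReal.ofReal (q (Φ (-s) y) ^ 2) := by
            rw [hF, indicator_of_mem hsSh]
          rw [e1, e2]
      _ ≤ ∫⁻ t in Icc 0 T, g t y :=
          lintegral_mono_set (Ioc_subset_Icc_self.trans (Icc_subset_Icc ht₁0 ht₂T))
  -- ### (b) Tonelli and the change of variables
  have hEm : MeasurableSet E := by
    have h1 : E = A \ {y | (T, y) ∈ G} := by
      ext y
      constructor
      · rintro ⟨hyA, σ, hσ, hlt⟩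
        exact ⟨hyA, fun hyG => absurd (hyG.2 σ hσ) (not_le.2 hlt)⟩
      · rintro ⟨hyA, hnot⟩
        refine ⟨hyA, ?_⟩
        by_contra hno
        simp only [mem_setOf_eq, not_exists, not_and, not_lt] at hno
        exact hnot ⟨hT.le, hno⟩
    rw [h1]
    exact hAm.diff (hGc.preimage (continuous_const.prodMk continuous_id)).measurableSet
  have hswap : ∫⁻ y in A, ∫⁻ t in Icc 0 T, g t y = ∫⁻ t in Icc 0 T, ∫⁻ y in A, g t y := by
    have hm : AEMeasurable (uncurry fun y t => g t y) ((volume.restrict A).prod (volume.restrict (Icc 0 T))) := by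
      have : (uncurry fun y t => g t y) = gp ∘ Prod.swap := by funext p; rfl
      rw [this]
      exact (hgpm.comp measurable_swap).aemeasurable
    exact lintegral_lintegral_swap hm
  have hinner : ∀ t ∈ Icc 0 T, ∫⁻ y in A, g t y ≤
      ENNReal.ofReal (Real.exp (3 * γ * T)) * ∫⁻ z in Sh ∩ Θ, ENNReal.ofReal (q z ^ 2) := by
    intro t ht
    set D : Set (EuclideanSpace ℝ (Fin 3)) := {y | (t, y) ∈ G} with hD
    have hDm : MeasurableSet D := (hGc.preimage (continuous_const.prodMk continuous_id)).measurableSet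
    have h1 : ∫⁻ y in A, g t y = ∫⁻ y in A ∩ D, F (Φ (-t) y) := by
      have h2 : ∀ y, g t y = D.indicator (fun y => F (Φ (-t) y)) y := by
        intro y
        by_cases hy : (t, y) ∈ G
        · have : y ∈ D := hy
          simp only [hg, hgp, indicator_of_mem hy, indicator_of_mem this]
        · have : y ∉ D := hy
          simp only [hg, hgp, indicator_of_notMem hy, indicator_of_notMem this]
      simp_rw [h2]
      rw [lintegral_indicator hDm, Measure.restrict_restrict hDm, inter_comm]
    have hstay : ∀ y ∈ A ∩ D, ∀ σ ∈ Icc 0 t, ‖Φ (-σ) y‖ ≤ Rb - 1 :=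
      fun y hy σ hσ => (hy.2.2 σ hσ).trans hMRb
    have h3 := lintegral_comp_backwardFlow_eq_of_stay (γ := γ) hV2 hK ht.1 hdiv (hAm.inter hDm) hstay F
    rw [h1, h3]
    refine mul_le_mul' (ENNReal.ofReal_le_ofReal (Real.exp_le_exp.2 ?_)) ?_
    · exact mul_le_mul_of_nonneg_left ht.2 (by positivity)
    · calc ∫⁻ z in Φ t ⁻¹' (A ∩ D), F z ≤ ∫⁻ z, F z := setLIntegral_le_lintegral _ _
        _ = ∫⁻ z in Sh ∩ Θ, ENNReal.ofReal (q z ^ 2) := by rw [hF, lintegral_indicator (hShm.inter hΘm)]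
  -- ### (c) the shell bound
  have hshell : ∫⁻ z in Sh ∩ Θ, ENNReal.ofReal (q z ^ 2) ≤
      ENNReal.ofReal (2 * γ ^ 2) * volume (Θ ∩ {z | M / 4 ≤ ‖z‖}) +
        ENNReal.ofReal (32 / M ^ 2) * ∫⁻ z in ball (0 : EuclideanSpace ℝ (Fin 3)) M, ‖U z‖ₑ ^ 2 := by
    have hpt : ∀ z ∈ Sh ∩ Θ, ENNReal.ofReal (q z ^ 2) ≤ ENNReal.ofReal (2 * γ ^ 2) + ENNReal.ofReal (32 / M ^ 2) * ‖U z‖ₑ ^ 2 := by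
      rintro z ⟨⟨hz1, hz2⟩, -⟩
      have hzR : ‖z‖ < Rb := by linarith
      have hqz : q z = ⟪z, γ • z + U z⟫ / ‖z‖ ^ 2 := by
        show ⟪z, selfSimilarTransport γ 0 V z⟫ / ‖z‖ ^ 2 = _
        rw [hWU z hzR, selfSimilarTransport_apply, sub_zero]
      have h1 := sq_radialRate_le (γ := γ) hM hz1 (U z)
      rw [hqz]
      calc ENNReal.ofReal ((⟪z, γ • z + U z⟫ / ‖z‖ ^ 2) ^ 2)
          ≤ ENNReal.ofReal (2 * γ ^ 2 + 32 / M ^ 2 * ‖U z‖ ^ 2) := ENNReal.ofReal_le_ofReal h1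
        _ = ENNReal.ofReal (2 * γ ^ 2) + ENNReal.ofReal (32 / M ^ 2) * ‖U z‖ₑ ^ 2 := by
            rw [← ofReal_norm (U z), ← ENNReal.ofReal_pow (norm_nonneg _),
              ← ENNReal.ofReal_mul (by positivity : (0 : ℝ) ≤ 32 / M ^ 2),
              ← ENNReal.ofReal_add (by positivity) (by positivity)]
    have hmeas : Measurable fun z : EuclideanSpace ℝ (Fin 3) => ENNReal.ofReal (2 * γ ^ 2) := measurable_const
    calc ∫⁻ z in Sh ∩ Θ, ENNReal.ofReal (q z ^ 2)
        ≤ ∫⁻ z in Sh ∩ Θ, (ENNReal.ofReal (2 * γ ^ 2) + ENNReal.ofReal (32 / M ^ 2) * ‖U z‖ₑ ^ 2) :=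
          lintegral_mono_ae ((ae_restrict_iff' (hShm.inter hΘm)).2 (Eventually.of_forall hpt))
      _ = ENNReal.ofReal (2 * γ ^ 2) * volume (Sh ∩ Θ) + ENNReal.ofReal (32 / M ^ 2) * ∫⁻ z in Sh ∩ Θ, ‖U z‖ₑ ^ 2 := by
          rw [lintegral_add_left' hmeas.aemeasurable, setLIntegral_const, lintegral_const_mul' _ _ ENNReal.ofReal_ne_top,
            mul_comm (ENNReal.ofReal (2 * γ ^ 2))]
      _ ≤ ENNReal.ofReal (2 * γ ^ 2) * volume (Θ ∩ {z | M / 4 ≤ ‖z‖}) +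
            ENNReal.ofReal (32 / M ^ 2) * ∫⁻ z in ball (0 : EuclideanSpace ℝ (Fin 3)) M, ‖U z‖ₑ ^ 2 := by
          apply add_le_add
          · exact mul_le_mul' le_rfl (measure_mono fun z hz => ⟨hz.2, hz.1.1⟩)
          · exact mul_le_mul' le_rfl (lintegral_mono_set fun z hz => by
              rw [mem_ball_zero_iff]; linarith [hz.1.2])
  -- ### assemble
  calc volume E * ENNReal.ofReal ((Real.log 2) ^ 2 / T)
      = ∫⁻ _ in E, ENNReal.ofReal ((Real.log 2) ^ 2 / T) := by rw [setLIntegral_const, mul_comm]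
    _ ≤ ∫⁻ y in E, ∫⁻ t in Icc 0 T, g t y := lintegral_mono_ae ((ae_restrict_iff' hEm).2 (Eventually.of_forall hlow))
    _ ≤ ∫⁻ y in A, ∫⁻ t in Icc 0 T, g t y := lintegral_mono_set inter_subset_left
    _ = ∫⁻ t in Icc 0 T, ∫⁻ y in A, g t y := hswap
    _ ≤ ∫⁻ _ in Icc 0 T, ENNReal.ofReal (Real.exp (3 * γ * T)) * ∫⁻ z in Sh ∩ Θ, ENNReal.ofReal (q z ^ 2) :=
        lintegral_mono_ae ((ae_restrict_iff' measurableSet_Icc).2 (Eventually.of_forall hinner))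
    _ = ENNReal.ofReal T * (ENNReal.ofReal (Real.exp (3 * γ * T)) * ∫⁻ z in Sh ∩ Θ, ENNReal.ofReal (q z ^ 2)) := by
        rw [setLIntegral_const, Real.volume_Icc, sub_zero, mul_comm]
    _ ≤ ENNReal.ofReal T * (ENNReal.ofReal (Real.exp (3 * γ * T)) *
          (ENNReal.ofReal (2 * γ ^ 2) * volume (Θ ∩ {z | M / 4 ≤ ‖z‖}) +
            ENNReal.ofReal (32 / M ^ 2) * ∫⁻ z in ball (0 : EuclideanSpace ℝ (Fin 3)) M, ‖U z‖ₑ ^ 2)) := by gcongr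
    _ = _ := by ring

end Summit.NavierStokesRegularity.NavierStokesRegularity.Theorems.PowerGaugeEulerLiouville.Loc

end
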